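import Summits.AtomisticToContinuum.HydrodynamicLimit.Theorems.AntiMazurCoboundariesCellForecastPressureDecayObjects
import HarnessLib.Audit

/-!
# Strategy census — typed artefacts (crux `CellForecastPressureDecay`, stmt-AtomisticToContinuum-13915)

Companion of `Cruxes/CellForecastPressureDecay/STRATEGY-CENSUS.md` (crux-strategist, wall-breaker pass,
2026-08-17). Nothing here is a line: these are the SIGNATURES the census refers to, elaborated against
the tree, plus the one glue that is provable now.

* § 1 `CellWindowPressureEventually` — the crux with the horizon clause `∃ T₀ ∀ T ≥ T₀` (the shape every
  registered skeleton actually proves); trivially implies the crux (`of_eventually`).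
* § 2 THE BEST TYPED SPLIT (census § Decomposition, D1 "currency split"):
  `CellWindowVarianceDecay` (the L² core = cell twin of stmt-10952 `FastObservableMeanErgodic`, NO rate,
  eventual in `T`, uniform in `n ≤ 2L³`; amplitude-free) and `CellRelativeGaussianity` (the LD upgrade:
  pressure ≤ `δL³ + 4c²·E(Σaᵢ)²`, slack factor 2 over the Gaussian value), with the PROVED glue
  `cellForecastPressureDecay_of_D1`. Both pieces are open; § Decomposition of the census explains why
  piece 1 is the irreducible core of the crux (every lens lands on it) and why the split is NOT filed.
* § 3 `CellWindowVarianceRate` — the strengthening with the Green–Kubo rate `C·L³/T` (shape of the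
  enskog line's `WindowL2Rate σ`, restated amplitude-free in this frame), recorded for § Strengthen.
-/

noncomputable section

open MeasureTheory Set Filter ProbabilityTheory Topology
open scoped ENNReal BigOperators
open Literature.Analysis.FluidPDE Literature.MathematicalPhysics.KineticTheory
open Summit.AtomisticToContinuum.HydrodynamicLimit.Theorems.TiltAnalyticity

namespace Summit.AtomisticToContinuum.HydrodynamicLimit.Cruxes.CellForecastPressureDecay.StrategyCensus

/-- The orthogonality clause of the crux, verbatim: `g ⊥ span(1, v, |v|²)` in `L²(stdGaussian)`. -/
def Orth (g : V3 → ℝ) : Prop :=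
  ∀ (c₀ c₂ : ℝ) (b : V3), ∫ v, g v * (c₀ + inner ℝ b v + c₂ * ‖v‖ ^ 2) ∂(stdGaussian V3) = 0

/-! ## § 1 The eventual-horizon form of the crux -/

/-- S⁺₀: the crux with `∃ T₀ ∀ T ≥ T₀` in place of `∃ T` (all other binders verbatim, in the
`cellLaw`/`windowAvg` vocabulary of the tilt objects module, which unfolds to the crux's text). -/
def CellWindowPressureEventually : Prop :=
  ∃ σ₀ : ℝ, 0 < σ₀ ∧ ∀ σ : ℝ, 0 < σ → σ < σ₀ → ∃ κ : ℝ, 0 < κ ∧ ∀ g : V3 → ℝ, Continuous g →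
    (∀ v, |g v| ≤ κ) → Orth g → ∀ δ : ℝ, 0 < δ → ∃ T₀ : ℝ, 0 < T₀ ∧ ∀ T : ℝ, T₀ ≤ T →
      ∃ R₀ : ℝ, 0 < R₀ ∧ ∀ R : ℝ, R₀ ≤ R → ∃ L₀ : ℝ, 0 < L₀ ∧ ∀ L : ℝ, L₀ ≤ L →
        ∀ n : ℕ, (n : ℝ) ≤ 2 * L ^ 3 → ∀ (Ψ : Flows σ) (c : ℝ), |c| ≤ 1 →
          ∫⁻ z, ENNReal.ofReal (Real.exp (2 * c * ∑ i : Fin n, windowAvg Ψ R T g z i))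
              ∂(cellLaw σ n L (Ψ n)) ≤ ENNReal.ofReal (Real.exp (δ * L ^ 3))

/-- The eventual form implies the crux (take `T := T₀`). -/
theorem of_eventually (h : CellWindowPressureEventually) :
    Summit.AtomisticToContinuum.HydrodynamicLimit.Theses.AntiMazurCoboundaries.CellForecastPressureDecay := by
  obtain ⟨σ₀, hσ₀, H⟩ := h
  refine ⟨σ₀, hσ₀, fun σ hσ hσ' => ?_⟩
  obtain ⟨κ, hκ, H⟩ := H σ hσ hσ'
  refine ⟨κ, hκ, fun g hg hgb horth δ hδ => ?_⟩
  obtain ⟨T₀, hT₀, H⟩ := H g hg hgb horth δ hδ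
  obtain ⟨R₀, hR₀, H⟩ := H T₀ le_rfl
  refine ⟨T₀, hT₀, R₀, hR₀, fun R hR => ?_⟩
  obtain ⟨L₀, hL₀, H⟩ := H R hR
  exact ⟨L₀, hL₀, fun L hL n hn Ψ c hc => H L hL n hn Ψ c hc⟩

/-! ## § 2 The currency split D1: L² core + relative Gaussianity -/

/-- D1 piece 1 — THE L² CORE (cell twin of stmt-10952, no rate): the cell variance functional of the
window sum is eventually `≤ δ L³`, uniformly in the density `n/L³ ≤ 2`. Amplitude-free (homogeneous of
degree 2 in `g`). This is the irreducible dynamical content of the crux (census § Decomposition): Cesàro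
decay to `0` of the normalised total-`g` autocorrelation of forecast velocities at FIXED `σ` — "no
one-body Drude weight of the deterministic dilute hard-sphere gas at fixed positive reduced density". -/
def CellWindowVarianceDecay : Prop :=
  ∃ σ₀ : ℝ, 0 < σ₀ ∧ ∀ σ : ℝ, 0 < σ → σ < σ₀ → ∀ g : V3 → ℝ, Continuous g →
    (∃ b : ℝ, ∀ v, |g v| ≤ b) → Orth g → ∀ δ : ℝ, 0 < δ → ∃ T₀ : ℝ, 0 < T₀ ∧ ∀ T : ℝ, T₀ ≤ T →
      ∃ R₀ : ℝ, 0 < R₀ ∧ ∀ R : ℝ, R₀ ≤ R → ∃ L₀ : ℝ, 0 < L₀ ∧ ∀ L : ℝ, L₀ ≤ L →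
        ∀ n : ℕ, (n : ℝ) ≤ 2 * L ^ 3 → ∀ Ψ : Flows σ,
          ∫ z, (∑ i : Fin n, windowAvg Ψ R T g z i) ^ 2 ∂(cellLaw σ n L (Ψ n)) ≤ δ * L ^ 3

/-- D1 piece 2 — RELATIVE GAUSSIANITY (the LD upgrade): at small amplitude the cell pressure exceeds
`4c² · E(Σaᵢ)²` (twice the Gaussian value) by at most `δ L³`, eventually in `T`. Its content is the
control of the cumulants of order `≥ 3` of the window sum (the tilt line's S3b at orders `≥ 3`, the
doubling card's "power saving"); open, census § Decomposition. -/
def CellRelativeGaussianity : Prop :=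
  ∃ σ₀ : ℝ, 0 < σ₀ ∧ ∀ σ : ℝ, 0 < σ → σ < σ₀ → ∃ κ : ℝ, 0 < κ ∧ ∀ g : V3 → ℝ, Continuous g →
    (∀ v, |g v| ≤ κ) → Orth g → ∀ δ : ℝ, 0 < δ → ∃ T₀ : ℝ, 0 < T₀ ∧ ∀ T : ℝ, T₀ ≤ T →
      ∃ R₀ : ℝ, 0 < R₀ ∧ ∀ R : ℝ, R₀ ≤ R → ∃ L₀ : ℝ, 0 < L₀ ∧ ∀ L : ℝ, L₀ ≤ L →
        ∀ n : ℕ, (n : ℝ) ≤ 2 * L ^ 3 → ∀ (Ψ : Flows σ) (c : ℝ), |c| ≤ 1 →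
          ∫⁻ z, ENNReal.ofReal (Real.exp (2 * c * ∑ i : Fin n, windowAvg Ψ R T g z i))
              ∂(cellLaw σ n L (Ψ n)) ≤
            ENNReal.ofReal (Real.exp (δ * L ^ 3 +
              4 * c ^ 2 * ∫ z, (∑ i : Fin n, windowAvg Ψ R T g z i) ^ 2 ∂(cellLaw σ n L (Ψ n))))

/-- **The D1 glue (PROVED):** L² core + relative Gaussianity ⇒ the crux, by name. Choices:
`σ₀ := min`, `κ` from piece 2, tolerances `δ/8` (variance) and `δ/2` (upgrade), `T := max T₀`,
`R₀ := max`, `L₀ := max`; then `δ/2·L³ + 4c²·V ≤ δ/2·L³ + 4·(δ/8)L³ = δL³` since `c² ≤ 1`, `V ≥ 0`. -/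
theorem cellForecastPressureDecay_of_D1 (h₁ : CellWindowVarianceDecay) (h₂ : CellRelativeGaussianity) :
    Summit.AtomisticToContinuum.HydrodynamicLimit.Theses.AntiMazurCoboundaries.CellForecastPressureDecay := by
  obtain ⟨σ₁, hσ₁, H1⟩ := h₁
  obtain ⟨σ₂, hσ₂, H2⟩ := h₂
  refine ⟨min σ₁ σ₂, lt_min hσ₁ hσ₂, fun σ hσ hσlt => ?_⟩
  have hσ1 : σ < σ₁ := hσlt.trans_le (min_le_left _ _)
  have hσ2 : σ < σ₂ := hσlt.trans_le (min_le_right _ _)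
  obtain ⟨κ, hκ, H2⟩ := H2 σ hσ hσ2
  refine ⟨κ, hκ, fun g hg hgb horth δ hδ => ?_⟩
  obtain ⟨T₁, hT₁, H1g⟩ := H1 σ hσ hσ1 g hg ⟨κ, hgb⟩ horth (δ / 8) (by positivity)
  obtain ⟨T₂, hT₂, H2g⟩ := H2 g hg hgb horth (δ / 2) (by positivity)
  obtain ⟨R₁, hR₁, H1T⟩ := H1g (max T₁ T₂) (le_max_left _ _)
  obtain ⟨R₂, hR₂, H2T⟩ := H2g (max T₁ T₂) (le_max_right _ _)
  refine ⟨max T₁ T₂, lt_max_of_lt_left hT₁, max R₁ R₂, lt_max_of_lt_left hR₁, fun R hR => ?_⟩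
  obtain ⟨L₁, hL₁, H1R⟩ := H1T R (le_of_max_le_left hR)
  obtain ⟨L₂, hL₂, H2R⟩ := H2T R (le_of_max_le_right hR)
  refine ⟨max L₁ L₂, lt_max_of_lt_left hL₁, fun L hL n hn Ψ c hc => ?_⟩
  have hV := H1R L (le_of_max_le_left hL) n hn Ψ
  have hE := H2R L (le_of_max_le_right hL) n hn Ψ c hc
  have hc2 : c ^ 2 ≤ 1 := by
    obtain ⟨h1, h2⟩ := abs_le.1 hc
    nlinarith
  have hVnn : 0 ≤ ∫ z, (∑ i : Fin n, windowAvg Ψ R (max T₁ T₂) g z i) ^ 2 ∂(cellLaw σ n L (Ψ n)) :=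
    integral_nonneg fun z => sq_nonneg _
  show ∫⁻ z, ENNReal.ofReal (Real.exp (2 * c * ∑ i : Fin n, windowAvg Ψ R (max T₁ T₂) g z i))
      ∂(cellLaw σ n L (Ψ n)) ≤ ENNReal.ofReal (Real.exp (δ * L ^ 3))
  refine hE.trans (ENNReal.ofReal_le_ofReal (Real.exp_le_exp.2 ?_))
  nlinarith [hV, hVnn, hc2, mul_nonneg (sub_nonneg.2 hc2) hVnn]

/-! ## § 3 The rate form (strengthening S⁺₂ of the census, shape of `WindowL2Rate σ`) -/

/-- S⁺₂ — the L² core WITH the Green–Kubo rate `C L³ / T` (enskog line's `WindowL2Rate σ`, restated in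
this frame without the centring constant): strictly stronger than `CellWindowVarianceDecay`
(`of_rate`), physically the `1/T` law `Var(Σaᵢ) ≈ 2nτ_g Var(g)/T`; open (worker W7's missing estimate). -/
def CellWindowVarianceRate : Prop :=
  ∃ σ₀ : ℝ, 0 < σ₀ ∧ ∀ σ : ℝ, 0 < σ → σ < σ₀ → ∀ g : V3 → ℝ, Continuous g →
    (∃ b : ℝ, ∀ v, |g v| ≤ b) → Orth g → ∃ C : ℝ, 0 < C ∧ ∃ T₀ : ℝ, 0 < T₀ ∧ ∀ T : ℝ, T₀ ≤ T →
      ∃ R₀ : ℝ, 0 < R₀ ∧ ∀ R : ℝ, R₀ ≤ R → ∃ L₀ : ℝ, 0 < L₀ ∧ ∀ L : ℝ, L₀ ≤ L →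
        ∀ n : ℕ, (n : ℝ) ≤ 2 * L ^ 3 → ∀ Ψ : Flows σ,
          ∫ z, (∑ i : Fin n, windowAvg Ψ R T g z i) ^ 2 ∂(cellLaw σ n L (Ψ n)) ≤ C * L ^ 3 / T

/-- The rate form implies the no-rate core (choose `T₀' := max T₀ (C/δ)`). -/
theorem of_rate (h : CellWindowVarianceRate) : CellWindowVarianceDecay := by
  obtain ⟨σ₀, hσ₀, H⟩ := h
  refine ⟨σ₀, hσ₀, fun σ hσ hσ' g hg hgb horth δ hδ => ?_⟩
  obtain ⟨C, hC, T₀, hT₀, H⟩ := H σ hσ hσ' g hg hgb horth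
  refine ⟨max T₀ (C / δ), lt_max_of_lt_left hT₀, fun T hT => ?_⟩
  obtain ⟨R₀, hR₀, H⟩ := H T (le_of_max_le_left hT)
  refine ⟨R₀, hR₀, fun R hR => ?_⟩
  obtain ⟨L₀, hL₀, H⟩ := H R hR
  refine ⟨max L₀ 1, lt_max_of_lt_left hL₀, fun L hL n hn Ψ => ?_⟩
  have hTpos : 0 < T := (lt_max_of_lt_left hT₀).trans_le hT
  have hCT : C / δ ≤ T := le_of_max_le_right hT
  have hL3 : 0 ≤ L ^ 3 := pow_nonneg (zero_le_one.trans (le_of_max_le_right hL)) 3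
  refine (H L (le_of_max_le_left hL) n hn Ψ).trans ?_
  rw [div_le_iff₀ hTpos]
  have hCle : C ≤ δ * T := by rwa [div_le_iff₀ hδ, mul_comm] at hCT
  calc C * L ^ 3 ≤ δ * T * L ^ 3 := by gcongr
    _ = δ * L ^ 3 * T := by ring

end Summit.AtomisticToContinuum.HydrodynamicLimit.Cruxes.CellForecastPressureDecay.StrategyCensus

end
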